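import Summits.BirchSwinnertonDyer.BirchSwinnertonDyer.Theorems.KimAtThreeFineKatoPerFactorSingle
import Summits.BirchSwinnertonDyer.BirchSwinnertonDyer.Theorems.KimAtThreeFineKatoPerFactorPlaces
import Summits.BirchSwinnertonDyer.BirchSwinnertonDyer.Theorems.KimAtThreeDeepLowerZetaBodyRatScaling
import Summits.BirchSwinnertonDyer.BirchSwinnertonDyer.Theorems.KimAtThreeDeepUpperExpStarFactsCanonical
import HarnessLib

/-!
# The `hdual` coupling of the uniform Kato package is REDUNDANT: hKatoV2ᵘ (`KimAtThreeDeepLowerKatoParts`) from the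
# (S5b) cite fact and the `hdual`-free, Kato-only package hKatoExᵘ — by a rescaling trick
# (cell `bsd-addord`, seat w2-c2 gen 9; route W2 `KimAtThreeKolyvagin`; `--supports stmt-BirchSwinnertonDyer-19075`, helper)

HONEST FRAMING.  TOOL theorem (no definition, no named fact, no instance attribute, no `sorry`); hKatoExᵘ is a
DISPLAYED hypothesis, (P123)/(DR)/(S5b) are the cite-only named facts of `Literature/…/PAdicHodge/DualExpElliptic`;
closes nothing; nothing booked; BSD is not proved by any of this.

WHAT.  hKatoV2ᵘ (= kim3's hKatoV2₀ minus the Kato-stratum binders and R-κ) displays per tower row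
`∃ d hinj hex, hdual(exp*_d) ∧ ∃ ι κK Λ, κK ≠ 0 ∧ (RES₀)/(DEF₀)(d, Λ) ∧ ZetaBody(κK, Λ)`: Kato's Euler system with
its value datum pinned to the DEFINED `exp*_d` for a line datum `d` that is SIMULTANEOUSLY duality-normalised at
`ℚ₃` — a coupling of [Kato 2004] with [BK90]/Tate duality through the (non-constructible) Néron class.  THIS FILE
removes the coupling: **`katoV2_of_katoExact_of_facts : (P123) → (DR) → (S5b) → hKatoExᵘ → hKatoV2ᵘ`**, where **hKatoExᵘ** is
hKatoV2ᵘ with the `hdual` conjunct AND the Prop-1.2.3 binders `hinj`/`hex` DELETED (the latter are w2-c3's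
`hinj_hex_of_facts`, cite) — «for SOME generator `d` of the Néron line `D⁰_dR(V₃W|ℚ_{v₀})`, Kato's Euler system has value datum `Λ` = the semi-local `exp*_d` (single completion, twist
family) with RATIONAL values (`ZetaBody` (C4))» — TRUE for Kato's own generator (the `S(f)`-class of Thm. 9.7
transported along `V₃(f)(1) ≅ V₃W`), i.e. Kato 2004 (8.1.3)/8.12/§9.4/9.7/6.6(1)/13.3 and nothing else: the
typer-lane target, now free of any duality clause.
PROOF (the rescaling trick).  (S5b) (w2-c3's `hdual_of_facts_of_ringHom`) rescales Kato's `d_K` to a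
duality-normalised `e • d_K`, `e ∈ ℚ_vˣ`; write `e₃⁻¹ e = 3ⁿ·w` with `‖w‖ = 1` (`n = v₃`, `Padic.norm_eq_zpow_neg_valuation`).
Take `d := 3ⁿ • d_K`: then `exp*_d = w · exp*_{e•d_K}` in `ℚ₃`, so `hdual` transfers (its lattice
`{a : ‖a·log_ω Q‖ ≤ 1}` is stable under `3`-adic units); the value datum of `d` is `3⁻ⁿ • Λ` — a RATIONAL rescaling,
so `ZetaBody(3⁻ⁿκK, 3⁻ⁿ•Λ)` (this seat's `zetaBody_rat_smul`); (RES₀)/(DEF₀) transport along the scale laws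
`exp*_{c•ω} = c⁻¹·exp*_ω` (w2-c2 g8 `expStarOmega_smul`) at `ℚ_{v₀}` and at `L_{w₀}` (`d_w ↦ (algebraMap c) • d_w`),
w2-acc4's `padicTensor_map_smul` (`Ψ(s•t)_w = e₃(s)·Ψ(t)_w`) and `galAdicCompletionMap_algebraMap_adicCompletion`.
NET for the 08-28 residual of the deep leaf: 19075 / 19679 / 19076 / 19562 / `N11.KimAtThreeDeepPUB` ⟸ 4 cite leaves ∧
{P123, DR, S5a, S5b} [cite] ∧ **hKatoExᵘ** [Kato 2004 over the DEFINED `exp*`, no duality clause] ∧ hLatᵘ [w2-c3 ⟸ (S5b-tower)]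
(`KimAtThreeDeepLowerKatoPartsCrux` §1 ∘ this file).  CAUTION kept from the evidence v13: the `∀ d ∀ e` and the
`∀ duality-normalised d` EXACT forms remain false; hKatoExᵘ is an `∃ d` statement whose witness is Kato's generator.

References: K. Kato, Astérisque 295 (2004) (8.1.3), Prop. 8.12, §9.4, Thm. 9.7, Thm. 6.6 (1), §11.3, Ex. 13.3
[Kato2004Asterisque]; K. Kato, LNM 1553 (1993) II §1.2.4, Ex. 1.3.5, Thm. 1.4.1 [Kato1993LNM1553]; S. Bloch, K. Kato (1990)
§3 Prop. 3.8, Ex. 3.11 [BlochKato1990]; J. W. S. Cassels, A. Fröhlich (1967) II §10 (10.2), VII §1.1 [CasselsFrohlichANT1967].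
-/

noncomputable section

-- the cell's Theorems namespace `Summit.BirchSwinnertonDyer.BirchSwinnertonDyer.…` repeats the summit name by design (D-0017)
set_option linter.dupNamespace false

open scoped Classical NumberField TensorProduct ContRepresentation Pointwise
open Field ValuativeRel Function IsDedekindDomain NumberField
open WeierstrassCurve Literature.NumberTheory.EllipticCurves Literature.NumberTheory.GaloisRepresentations
  Literature.NumberTheory.GaloisRepresentations.DiscreteGaloisModule Literature.NumberTheory.GaloisCohomology
open Literature.NumberTheory.GaloisRepresentations.PeriodRingData Literature.NumberTheory.PAdicHodge
open Literature.NumberTheory.EllipticCurves.ModularForms Literature.NumberTheory.EllipticCurves.Rank1Residual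
open Literature.NumberTheory.EllipticCurves.Kato2004 Literature.NumberTheory.EllipticCurves.Kato2004.EulerSystemValues
open Literature.NumberTheory.AdelicBaseChange Literature.NumberTheory.Automorphic
open Summit.BirchSwinnertonDyer.Rank1Residual.GaloisImage
open Summit.BirchSwinnertonDyer.Rank1Residual.Additive.LocalLog
open Summit.BirchSwinnertonDyer.BirchSwinnertonDyer.Theorems
open Summit.BirchSwinnertonDyer.BirchSwinnertonDyer.Theorems.KimAtThreeFineKatoPerFactorDefined
open Summit.BirchSwinnertonDyer.BirchSwinnertonDyer.Theorems.KimAtThreeDeepLowerExpStarOmega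
open Summit.BirchSwinnertonDyer.BirchSwinnertonDyer.Theorems.KimAtThreeDeepLowerExpStarOmegaPlace
open Summit.BirchSwinnertonDyer.BirchSwinnertonDyer.Theorems.KimAtThreeFineKatoPerFactorPlaces
open Summit.BirchSwinnertonDyer.BirchSwinnertonDyer.Theorems.KimAtThreeDeepUpperExpStarFacts
open Summit.BirchSwinnertonDyer.BirchSwinnertonDyer.Theorems.KimAtThreeDeepUpperExpStarFactsCanonical
open Summit.BirchSwinnertonDyer.BirchSwinnertonDyer.Theorems.KimAtThreeDeepLowerZetaBodyRatScaling

namespace Summit.BirchSwinnertonDyer.BirchSwinnertonDyer.Theorems.KimAtThreeDeepLowerKatoPartsRescale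

set_option backward.isDefEq.respectTransparency false in
set_option maxHeartbeats 1600000 in
/-- **hKatoV2ᵘ from (P123), (DR), (S5b) and the `hdual`-free Kato package hKatoExᵘ** (module docstring: rescale Kato's line datum
by the `3`-power part of the duality rescaling, its value datum by the inverse RATIONAL power, and absorb the unit
part in `hdual`).  hKatoExᵘ displayed, the three facts cite-only; closes nothing.
[cite: Kato2004Asterisque, (8.1.3) (p. 180), Prop. 8.12 (p. 186), §9.4 and Thm. 9.7 (pp. 188–189), Thm. 6.6 (1) (p. 163), Ex. 13.3 (pp. 224–225)]
[cite: Kato1993LNM1553, Ch. II §1.2.4 and Thm. 1.4.1] [cite: BlochKato1990, §3 (Prop. 3.8, Ex. 3.11)]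
[cite: CasselsFrohlichANT1967, Ch. II §10 Theorem (10.2) and Ch. VII §1.1]
(`maxHeartbeats 1600000`: two ≈ 90-line displayed packages with `letI` instance terms in ONE signature — statement
`whnf` + `refine` alone exceed 800000; kim3 / w2-acc4 GOTCHA.) -/
theorem katoV2_of_katoExact_of_facts (hP : cupLogInjective_and_hasDualExp_of_isDeRham)
    (hDR : isDeRham_restrictedRationalTateRep) (hT : exists_smul_range_expStarCoord_iff_trace_log)
    (hKatoEx : ∀ (W : WeierstrassCurve ℚ) [W.IsElliptic] [W.IsGloballyMinimal]
      [ContinuousSMul ℤ_[3] (W.tateModule 3)] [Module.Free ℤ_[3] (W.tateModule 3)]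
      [Module.Finite ℤ_[3] (W.tateModule 3)],
      (∀ m : ℕ, W.HasSurjectiveModNGaloisRep (3 ^ m : ℕ)) →
      ∀ {N : ℕ} [NeZero N] (P : ModularParametrizationData W N), N = W.conductorNorm ℤ →
        (∀ z ∈ P.L.lattice, ∃ w ∈ periodLattice P.f, z = P.c * w) →
        haveI : Fact (((3 : ℕ) : 𝓞 ℚ) ∈ ((Rat.HeightOneSpectrum.primesEquiv (R := 𝓞 ℚ)).symm ⟨3, Fact.out⟩).asIdeal) :=
          ⟨(natCast_mem_asIdeal_iff_eq_primesEquiv_symm _ Nat.prime_three).mpr rfl⟩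
        letI := valuativeRelPlace ((Rat.HeightOneSpectrum.primesEquiv (R := 𝓞 ℚ)).symm ⟨3, Fact.out⟩)
        letI := topologicalSpacePlace ((Rat.HeightOneSpectrum.primesEquiv (R := 𝓞 ℚ)).symm ⟨3, Fact.out⟩)
        haveI := isNonarchimedeanLocalField_place ((Rat.HeightOneSpectrum.primesEquiv (R := 𝓞 ℚ)).symm ⟨3, Fact.out⟩)
        haveI := charZero_place ((Rat.HeightOneSpectrum.primesEquiv (R := 𝓞 ℚ)).symm ⟨3, Fact.out⟩)
        letI := padicAlgebraPlace 3 ((Rat.HeightOneSpectrum.primesEquiv (R := 𝓞 ℚ)).symm ⟨3, Fact.out⟩)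
        haveI := fact_not_isUnit_place 3 ((Rat.HeightOneSpectrum.primesEquiv (R := 𝓞 ℚ)).symm ⟨3, Fact.out⟩)
        haveI := isAdicComplete_place 3 ((Rat.HeightOneSpectrum.primesEquiv (R := 𝓞 ℚ)).symm ⟨3, Fact.out⟩)
        ∃ (d : LocalNeronLineAt W 3 ((Rat.HeightOneSpectrum.primesEquiv (R := 𝓞 ℚ)).symm ⟨3, Fact.out⟩)),
        ∃ (ι : (n : ℕ) → (CyclotomicField n ℚ →+* ℂ)) (κK : ℝ)
          (Λ : ∀ (k' : ℕ) (r : Finset (HeightOneSpectrum (𝓞 ℚ))),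
            H1 (tateRep W 3) (cycSubgroup 3 k' r) →ₗ[ℤ_[3]]
              ℚ_[3] ⊗[ℚ] CyclotomicField (cycLevel 3 k' r) ℚ),
          κK ≠ 0 ∧
          (∀ (j : ℕ) (r : Finset (HeightOneSpectrum (𝓞 ℚ)))
            (Ψ : ℚ_[3] ⊗[ℚ] CyclotomicField (cycLevel 3 0 r) ℚ ≃ₐ[ℚ]
              (Π w : ((Rat.HeightOneSpectrum.primesEquiv (R := 𝓞 ℚ)).symm ⟨3, Fact.out⟩).Extension
                (𝓞 (CyclotomicField (cycLevel 3 0 r) ℚ)), w.1.adicCompletion (CyclotomicField (cycLevel 3 0 r) ℚ)))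
            (hΨ : ∀ (s : ℚ_[3]) (x : CyclotomicField (cycLevel 3 0 r) ℚ)
              (w : ((Rat.HeightOneSpectrum.primesEquiv (R := 𝓞 ℚ)).symm ⟨3, Fact.out⟩).Extension
                (𝓞 (CyclotomicField (cycLevel 3 0 r) ℚ))),
              Ψ (s ⊗ₜ[ℚ] x) w =
                algebraMap (CyclotomicField (cycLevel 3 0 r) ℚ) (w.1.adicCompletion (CyclotomicField (cycLevel 3 0 r) ℚ)) x *
                algebraMap (((Rat.HeightOneSpectrum.primesEquiv (R := 𝓞 ℚ)).symm ⟨3, Fact.out⟩).adicCompletion ℚ)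
                  (w.1.adicCompletion (CyclotomicField (cycLevel 3 0 r) ℚ)) ((Padic.adicCompletionEquiv (𝓞 ℚ) ⟨3, Fact.out⟩) s)),
            ∃ (w₀ : ((Rat.HeightOneSpectrum.primesEquiv (R := 𝓞 ℚ)).symm ⟨3, Fact.out⟩).Extension
                (𝓞 (CyclotomicField (cycLevel 3 0 r) ℚ)))
              (g : ((Rat.HeightOneSpectrum.primesEquiv (R := 𝓞 ℚ)).symm ⟨3, Fact.out⟩).Extension
                (𝓞 (CyclotomicField (cycLevel 3 0 r) ℚ)) → absoluteGaloisGroup ℚ)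
              (hg : ∀ w : ((Rat.HeightOneSpectrum.primesEquiv (R := 𝓞 ℚ)).symm ⟨3, Fact.out⟩).Extension
                (𝓞 (CyclotomicField (cycLevel 3 0 r) ℚ)),
                sigma (cycLevel 3 0 r) (modNCyclotomicCharacter ℚ (cycLevel 3 0 r) (g w)) • w.1 = w₀.1),
                letI := LocalField.charZero_adicCompletion w₀.1
                letI := LocalField.adicCompletionPadicAlgebra w₀.1 3 (three_mem_asIdeal_extension _ w₀)
                haveI : Fact (¬ IsUnit ((3 : ℕ) : integerC (w₀.1.adicCompletion (CyclotomicField (cycLevel 3 0 r) ℚ)))) :=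
                  ⟨not_isUnit_natCast_integerC (LocalField.valuation_adicCompletion_natCast_lt_one w₀.1 3 (three_mem_asIdeal_extension _ w₀))⟩
                haveI := isAdicComplete_integerC_natCast (LocalField.valuation_adicCompletion_natCast_lt_one w₀.1 3 (three_mem_asIdeal_extension _ w₀))
                ∃ (dw : LocalNeronLine W (LocalField.valuation_adicCompletion_natCast_lt_one w₀.1 3 (three_mem_asIdeal_extension _ w₀))
                  ((galRestrictPlace ((Rat.HeightOneSpectrum.primesEquiv (R := 𝓞 ℚ)).symm ⟨3, Fact.out⟩)).comp
                    (absGaloisRestrict (((Rat.HeightOneSpectrum.primesEquiv (R := 𝓞 ℚ)).symm ⟨3, Fact.out⟩).adicCompletion ℚ) (w₀.1.adicCompletion (CyclotomicField (cycLevel 3 0 r) ℚ)))))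
                  (hinjw : (bdRPeriodRingData (LocalField.valuation_adicCompletion_natCast_lt_one w₀.1 3 (three_mem_asIdeal_extension _ w₀))).CupLogInjective
                  (logCyclotomic 3) (localRationalTateRep W 3 ((galRestrictPlace ((Rat.HeightOneSpectrum.primesEquiv (R := 𝓞 ℚ)).symm ⟨3, Fact.out⟩)).comp
                    (absGaloisRestrict (((Rat.HeightOneSpectrum.primesEquiv (R := 𝓞 ℚ)).symm ⟨3, Fact.out⟩).adicCompletion ℚ) (w₀.1.adicCompletion (CyclotomicField (cycLevel 3 0 r) ℚ))))))
                  (hexw : ∀ z : contOneCocycles (localRationalTateRep W 3 ((galRestrictPlace ((Rat.HeightOneSpectrum.primesEquiv (R := 𝓞 ℚ)).symm ⟨3, Fact.out⟩)).comp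
                    (absGaloisRestrict (((Rat.HeightOneSpectrum.primesEquiv (R := 𝓞 ℚ)).symm ⟨3, Fact.out⟩).adicCompletion ℚ) (w₀.1.adicCompletion (CyclotomicField (cycLevel 3 0 r) ℚ))))).toTopRep,
                  (bdRPeriodRingData (LocalField.valuation_adicCompletion_natCast_lt_one w₀.1 3 (three_mem_asIdeal_extension _ w₀))).HasDualExp
                    (logCyclotomic 3) (localRationalTateRep W 3 ((galRestrictPlace ((Rat.HeightOneSpectrum.primesEquiv (R := 𝓞 ℚ)).symm ⟨3, Fact.out⟩)).comp
                    (absGaloisRestrict (((Rat.HeightOneSpectrum.primesEquiv (R := 𝓞 ℚ)).symm ⟨3, Fact.out⟩).adicCompletion ℚ) (w₀.1.adicCompletion (CyclotomicField (cycLevel 3 0 r) ℚ))))) fun σ => z.1 σ),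
                  (∀ (h : (tateLocalRep W 3 (Sum.inr ((Rat.HeightOneSpectrum.primesEquiv (R := 𝓞 ℚ)).symm ⟨3, Fact.out⟩))).cohomology 1),
                  (expStarOmegaHom (LocalField.valuation_adicCompletion_natCast_lt_one w₀.1 3 (three_mem_asIdeal_extension _ w₀))
                    ((galRestrictPlace ((Rat.HeightOneSpectrum.primesEquiv (R := 𝓞 ℚ)).symm ⟨3, Fact.out⟩)).comp
                    (absGaloisRestrict (((Rat.HeightOneSpectrum.primesEquiv (R := 𝓞 ℚ)).symm ⟨3, Fact.out⟩).adicCompletion ℚ) (w₀.1.adicCompletion (CyclotomicField (cycLevel 3 0 r) ℚ)))) dw hinjw hexw)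
                    (ContinuousRep.cohomologyRes (tateLocalRep W 3 (Sum.inr ((Rat.HeightOneSpectrum.primesEquiv (R := 𝓞 ℚ)).symm ⟨3, Fact.out⟩)))
                      (absGaloisRestrict (((Rat.HeightOneSpectrum.primesEquiv (R := 𝓞 ℚ)).symm ⟨3, Fact.out⟩).adicCompletion ℚ) (w₀.1.adicCompletion (CyclotomicField (cycLevel 3 0 r) ℚ))) 1 h) =
                  algebraMap (((Rat.HeightOneSpectrum.primesEquiv (R := 𝓞 ℚ)).symm ⟨3, Fact.out⟩).adicCompletion ℚ) (w₀.1.adicCompletion (CyclotomicField (cycLevel 3 0 r) ℚ)) (expStarOmegaAt d h)) ∧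
                  (∀ (w : ((Rat.HeightOneSpectrum.primesEquiv (R := 𝓞 ℚ)).symm ⟨3, Fact.out⟩).Extension
                    (𝓞 (CyclotomicField (cycLevel 3 0 r) ℚ)))
                  (y : H1 (tateRep W 3) (cycSubgroup 3 0 r))
                  (φ'' : contOneCocycles (subgroupRep (tateRep W 3).toTopRep (cycSubgroup 3 0 r)))
                  (ψT : contOneCocycles ((tateLocalRep W 3 (Sum.inr ((Rat.HeightOneSpectrum.primesEquiv (R := 𝓞 ℚ)).symm ⟨3, Fact.out⟩))).restrict
                    (absGaloisRestrict (((Rat.HeightOneSpectrum.primesEquiv (R := 𝓞 ℚ)).symm ⟨3, Fact.out⟩).adicCompletion ℚ) (w₀.1.adicCompletion (CyclotomicField (cycLevel 3 0 r) ℚ)))).toTopRep),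
                  oneCocycleClass _ φ'' = conjMap (tateRep W 3).toTopRep (cycSubgroup 3 0 r) (g w) 1 y →
                  (∀ σ, ψT.1 σ = φ''.1 ⟨absGaloisRestrictTower ℚ (((Rat.HeightOneSpectrum.primesEquiv (R := 𝓞 ℚ)).symm ⟨3, Fact.out⟩).adicCompletion ℚ) (w₀.1.adicCompletion (CyclotomicField (cycLevel 3 0 r) ℚ)) σ,
                    absGaloisRestrictTower_adicCompletion_mem_cycSubgroup r w₀ σ⟩) →
                  Ψ (Λ 0 r y) w = galAdicCompletionMap
                    (sigma (cycLevel 3 0 r) (modNCyclotomicCharacter ℚ (cycLevel 3 0 r) (g w)))⁻¹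
                    (inv_smul_eq_of_smul_eq (hg w))
                    ((expStarOmegaHom (LocalField.valuation_adicCompletion_natCast_lt_one w₀.1 3 (three_mem_asIdeal_extension _ w₀))
                    ((galRestrictPlace ((Rat.HeightOneSpectrum.primesEquiv (R := 𝓞 ℚ)).symm ⟨3, Fact.out⟩)).comp
                    (absGaloisRestrict (((Rat.HeightOneSpectrum.primesEquiv (R := 𝓞 ℚ)).symm ⟨3, Fact.out⟩).adicCompletion ℚ) (w₀.1.adicCompletion (CyclotomicField (cycLevel 3 0 r) ℚ)))) dw hinjw hexw) (oneCocycleClass _ ψT)))) ∧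
          ∀ (c d a : ℤ) (A : ℕ), 0 < A → Int.gcd c (6 * 3 * A) = 1 → Int.gcd d (6 * 3 * N) = 1 →
            ∃ (z : ∀ (k' : ℕ) (r : (cyclotomicLevelsRat 3 (badPlaces c d A N)).Ideals),
                  H1 (tateRep W 3) ((cyclotomicLevelsRat 3 (badPlaces c d A N)).level k' r.1))
              (x : ∀ (k' : ℕ) (r : (cyclotomicLevelsRat 3 (badPlaces c d A N)).Ideals),
                  CyclotomicField (cycLevel 3 k' r.1) ℚ),
              ZetaBody W 3 P.f ι κK Λ c d a A z x) :
    ∀ (W : WeierstrassCurve ℚ) [W.IsElliptic] [W.IsGloballyMinimal]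
      [ContinuousSMul ℤ_[3] (W.tateModule 3)] [Module.Free ℤ_[3] (W.tateModule 3)]
      [Module.Finite ℤ_[3] (W.tateModule 3)],
      (∀ m : ℕ, W.HasSurjectiveModNGaloisRep (3 ^ m : ℕ)) →
      ∀ {N : ℕ} [NeZero N] (P : ModularParametrizationData W N), N = W.conductorNorm ℤ →
        (∀ z ∈ P.L.lattice, ∃ w ∈ periodLattice P.f, z = P.c * w) →
        haveI : Fact (((3 : ℕ) : 𝓞 ℚ) ∈ ((Rat.HeightOneSpectrum.primesEquiv (R := 𝓞 ℚ)).symm ⟨3, Fact.out⟩).asIdeal) :=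
          ⟨(natCast_mem_asIdeal_iff_eq_primesEquiv_symm _ Nat.prime_three).mpr rfl⟩
        letI := valuativeRelPlace ((Rat.HeightOneSpectrum.primesEquiv (R := 𝓞 ℚ)).symm ⟨3, Fact.out⟩)
        letI := topologicalSpacePlace ((Rat.HeightOneSpectrum.primesEquiv (R := 𝓞 ℚ)).symm ⟨3, Fact.out⟩)
        haveI := isNonarchimedeanLocalField_place ((Rat.HeightOneSpectrum.primesEquiv (R := 𝓞 ℚ)).symm ⟨3, Fact.out⟩)
        haveI := charZero_place ((Rat.HeightOneSpectrum.primesEquiv (R := 𝓞 ℚ)).symm ⟨3, Fact.out⟩)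
        letI := padicAlgebraPlace 3 ((Rat.HeightOneSpectrum.primesEquiv (R := 𝓞 ℚ)).symm ⟨3, Fact.out⟩)
        haveI := fact_not_isUnit_place 3 ((Rat.HeightOneSpectrum.primesEquiv (R := 𝓞 ℚ)).symm ⟨3, Fact.out⟩)
        haveI := isAdicComplete_place 3 ((Rat.HeightOneSpectrum.primesEquiv (R := 𝓞 ℚ)).symm ⟨3, Fact.out⟩)
        ∃ (d : LocalNeronLineAt W 3 ((Rat.HeightOneSpectrum.primesEquiv (R := 𝓞 ℚ)).symm ⟨3, Fact.out⟩))
          (hinj : (bdRPeriodRingData (valuation_place_lt_one 3 ((Rat.HeightOneSpectrum.primesEquiv (R := 𝓞 ℚ)).symm ⟨3, Fact.out⟩))).CupLogInjective (logCyclotomic 3)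
            (localRationalTateRep W 3 (galRestrictPlace ((Rat.HeightOneSpectrum.primesEquiv (R := 𝓞 ℚ)).symm ⟨3, Fact.out⟩))))
          (hex : ∀ z : contOneCocycles (localRationalTateRep W 3 (galRestrictPlace ((Rat.HeightOneSpectrum.primesEquiv (R := 𝓞 ℚ)).symm ⟨3, Fact.out⟩))).toTopRep,
            (bdRPeriodRingData (valuation_place_lt_one 3 ((Rat.HeightOneSpectrum.primesEquiv (R := 𝓞 ℚ)).symm ⟨3, Fact.out⟩))).HasDualExp (logCyclotomic 3)
              (localRationalTateRep W 3 (galRestrictPlace ((Rat.HeightOneSpectrum.primesEquiv (R := 𝓞 ℚ)).symm ⟨3, Fact.out⟩))) fun σ => z.1 σ),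
          (∀ a : ℚ_[3], (∃ y, (expStarOmegaPadicAt d hinj hex (((Padic.adicCompletionEquiv (𝓞 ℚ) ⟨3, Fact.out⟩).symm : (((Rat.HeightOneSpectrum.primesEquiv (R := 𝓞 ℚ)).symm ⟨3, Fact.out⟩).adicCompletion ℚ) →+* ℚ_[3]))) y = a) ↔
            ∀ Q : (W.baseChange ℚ_[3]).toAffine.Point, ‖a * padicLog (W.baseChange ℚ_[3]) Q‖ ≤ 1) ∧
        ∃ (ι : (n : ℕ) → (CyclotomicField n ℚ →+* ℂ)) (κK : ℝ)
          (Λ : ∀ (k' : ℕ) (r : Finset (HeightOneSpectrum (𝓞 ℚ))),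
            H1 (tateRep W 3) (cycSubgroup 3 k' r) →ₗ[ℤ_[3]]
              ℚ_[3] ⊗[ℚ] CyclotomicField (cycLevel 3 k' r) ℚ),
          κK ≠ 0 ∧
          (∀ (j : ℕ) (r : Finset (HeightOneSpectrum (𝓞 ℚ)))
            (Ψ : ℚ_[3] ⊗[ℚ] CyclotomicField (cycLevel 3 0 r) ℚ ≃ₐ[ℚ]
              (Π w : ((Rat.HeightOneSpectrum.primesEquiv (R := 𝓞 ℚ)).symm ⟨3, Fact.out⟩).Extension
                (𝓞 (CyclotomicField (cycLevel 3 0 r) ℚ)), w.1.adicCompletion (CyclotomicField (cycLevel 3 0 r) ℚ)))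
            (hΨ : ∀ (s : ℚ_[3]) (x : CyclotomicField (cycLevel 3 0 r) ℚ)
              (w : ((Rat.HeightOneSpectrum.primesEquiv (R := 𝓞 ℚ)).symm ⟨3, Fact.out⟩).Extension
                (𝓞 (CyclotomicField (cycLevel 3 0 r) ℚ))),
              Ψ (s ⊗ₜ[ℚ] x) w =
                algebraMap (CyclotomicField (cycLevel 3 0 r) ℚ) (w.1.adicCompletion (CyclotomicField (cycLevel 3 0 r) ℚ)) x *
                algebraMap (((Rat.HeightOneSpectrum.primesEquiv (R := 𝓞 ℚ)).symm ⟨3, Fact.out⟩).adicCompletion ℚ)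
                  (w.1.adicCompletion (CyclotomicField (cycLevel 3 0 r) ℚ)) ((Padic.adicCompletionEquiv (𝓞 ℚ) ⟨3, Fact.out⟩) s)),
            ∃ (w₀ : ((Rat.HeightOneSpectrum.primesEquiv (R := 𝓞 ℚ)).symm ⟨3, Fact.out⟩).Extension
                (𝓞 (CyclotomicField (cycLevel 3 0 r) ℚ)))
              (g : ((Rat.HeightOneSpectrum.primesEquiv (R := 𝓞 ℚ)).symm ⟨3, Fact.out⟩).Extension
                (𝓞 (CyclotomicField (cycLevel 3 0 r) ℚ)) → absoluteGaloisGroup ℚ)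
              (hg : ∀ w : ((Rat.HeightOneSpectrum.primesEquiv (R := 𝓞 ℚ)).symm ⟨3, Fact.out⟩).Extension
                (𝓞 (CyclotomicField (cycLevel 3 0 r) ℚ)),
                sigma (cycLevel 3 0 r) (modNCyclotomicCharacter ℚ (cycLevel 3 0 r) (g w)) • w.1 = w₀.1),
                letI := LocalField.charZero_adicCompletion w₀.1
                letI := LocalField.adicCompletionPadicAlgebra w₀.1 3 (three_mem_asIdeal_extension _ w₀)
                haveI : Fact (¬ IsUnit ((3 : ℕ) : integerC (w₀.1.adicCompletion (CyclotomicField (cycLevel 3 0 r) ℚ)))) :=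
                  ⟨not_isUnit_natCast_integerC (LocalField.valuation_adicCompletion_natCast_lt_one w₀.1 3 (three_mem_asIdeal_extension _ w₀))⟩
                haveI := isAdicComplete_integerC_natCast (LocalField.valuation_adicCompletion_natCast_lt_one w₀.1 3 (three_mem_asIdeal_extension _ w₀))
                ∃ (dw : LocalNeronLine W (LocalField.valuation_adicCompletion_natCast_lt_one w₀.1 3 (three_mem_asIdeal_extension _ w₀))
                  ((galRestrictPlace ((Rat.HeightOneSpectrum.primesEquiv (R := 𝓞 ℚ)).symm ⟨3, Fact.out⟩)).comp
                    (absGaloisRestrict (((Rat.HeightOneSpectrum.primesEquiv (R := 𝓞 ℚ)).symm ⟨3, Fact.out⟩).adicCompletion ℚ) (w₀.1.adicCompletion (CyclotomicField (cycLevel 3 0 r) ℚ)))))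
                  (hinjw : (bdRPeriodRingData (LocalField.valuation_adicCompletion_natCast_lt_one w₀.1 3 (three_mem_asIdeal_extension _ w₀))).CupLogInjective
                  (logCyclotomic 3) (localRationalTateRep W 3 ((galRestrictPlace ((Rat.HeightOneSpectrum.primesEquiv (R := 𝓞 ℚ)).symm ⟨3, Fact.out⟩)).comp
                    (absGaloisRestrict (((Rat.HeightOneSpectrum.primesEquiv (R := 𝓞 ℚ)).symm ⟨3, Fact.out⟩).adicCompletion ℚ) (w₀.1.adicCompletion (CyclotomicField (cycLevel 3 0 r) ℚ))))))
                  (hexw : ∀ z : contOneCocycles (localRationalTateRep W 3 ((galRestrictPlace ((Rat.HeightOneSpectrum.primesEquiv (R := 𝓞 ℚ)).symm ⟨3, Fact.out⟩)).comp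
                    (absGaloisRestrict (((Rat.HeightOneSpectrum.primesEquiv (R := 𝓞 ℚ)).symm ⟨3, Fact.out⟩).adicCompletion ℚ) (w₀.1.adicCompletion (CyclotomicField (cycLevel 3 0 r) ℚ))))).toTopRep,
                  (bdRPeriodRingData (LocalField.valuation_adicCompletion_natCast_lt_one w₀.1 3 (three_mem_asIdeal_extension _ w₀))).HasDualExp
                    (logCyclotomic 3) (localRationalTateRep W 3 ((galRestrictPlace ((Rat.HeightOneSpectrum.primesEquiv (R := 𝓞 ℚ)).symm ⟨3, Fact.out⟩)).comp
                    (absGaloisRestrict (((Rat.HeightOneSpectrum.primesEquiv (R := 𝓞 ℚ)).symm ⟨3, Fact.out⟩).adicCompletion ℚ) (w₀.1.adicCompletion (CyclotomicField (cycLevel 3 0 r) ℚ))))) fun σ => z.1 σ),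
                  (∀ (h : (tateLocalRep W 3 (Sum.inr ((Rat.HeightOneSpectrum.primesEquiv (R := 𝓞 ℚ)).symm ⟨3, Fact.out⟩))).cohomology 1),
                  (expStarOmegaHom (LocalField.valuation_adicCompletion_natCast_lt_one w₀.1 3 (three_mem_asIdeal_extension _ w₀))
                    ((galRestrictPlace ((Rat.HeightOneSpectrum.primesEquiv (R := 𝓞 ℚ)).symm ⟨3, Fact.out⟩)).comp
                    (absGaloisRestrict (((Rat.HeightOneSpectrum.primesEquiv (R := 𝓞 ℚ)).symm ⟨3, Fact.out⟩).adicCompletion ℚ) (w₀.1.adicCompletion (CyclotomicField (cycLevel 3 0 r) ℚ)))) dw hinjw hexw)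
                    (ContinuousRep.cohomologyRes (tateLocalRep W 3 (Sum.inr ((Rat.HeightOneSpectrum.primesEquiv (R := 𝓞 ℚ)).symm ⟨3, Fact.out⟩)))
                      (absGaloisRestrict (((Rat.HeightOneSpectrum.primesEquiv (R := 𝓞 ℚ)).symm ⟨3, Fact.out⟩).adicCompletion ℚ) (w₀.1.adicCompletion (CyclotomicField (cycLevel 3 0 r) ℚ))) 1 h) =
                  algebraMap (((Rat.HeightOneSpectrum.primesEquiv (R := 𝓞 ℚ)).symm ⟨3, Fact.out⟩).adicCompletion ℚ) (w₀.1.adicCompletion (CyclotomicField (cycLevel 3 0 r) ℚ)) (expStarOmegaAt d h)) ∧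
                  (∀ (w : ((Rat.HeightOneSpectrum.primesEquiv (R := 𝓞 ℚ)).symm ⟨3, Fact.out⟩).Extension
                    (𝓞 (CyclotomicField (cycLevel 3 0 r) ℚ)))
                  (y : H1 (tateRep W 3) (cycSubgroup 3 0 r))
                  (φ'' : contOneCocycles (subgroupRep (tateRep W 3).toTopRep (cycSubgroup 3 0 r)))
                  (ψT : contOneCocycles ((tateLocalRep W 3 (Sum.inr ((Rat.HeightOneSpectrum.primesEquiv (R := 𝓞 ℚ)).symm ⟨3, Fact.out⟩))).restrict
                    (absGaloisRestrict (((Rat.HeightOneSpectrum.primesEquiv (R := 𝓞 ℚ)).symm ⟨3, Fact.out⟩).adicCompletion ℚ) (w₀.1.adicCompletion (CyclotomicField (cycLevel 3 0 r) ℚ)))).toTopRep),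
                  oneCocycleClass _ φ'' = conjMap (tateRep W 3).toTopRep (cycSubgroup 3 0 r) (g w) 1 y →
                  (∀ σ, ψT.1 σ = φ''.1 ⟨absGaloisRestrictTower ℚ (((Rat.HeightOneSpectrum.primesEquiv (R := 𝓞 ℚ)).symm ⟨3, Fact.out⟩).adicCompletion ℚ) (w₀.1.adicCompletion (CyclotomicField (cycLevel 3 0 r) ℚ)) σ,
                    absGaloisRestrictTower_adicCompletion_mem_cycSubgroup r w₀ σ⟩) →
                  Ψ (Λ 0 r y) w = galAdicCompletionMap
                    (sigma (cycLevel 3 0 r) (modNCyclotomicCharacter ℚ (cycLevel 3 0 r) (g w)))⁻¹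
                    (inv_smul_eq_of_smul_eq (hg w))
                    ((expStarOmegaHom (LocalField.valuation_adicCompletion_natCast_lt_one w₀.1 3 (three_mem_asIdeal_extension _ w₀))
                    ((galRestrictPlace ((Rat.HeightOneSpectrum.primesEquiv (R := 𝓞 ℚ)).symm ⟨3, Fact.out⟩)).comp
                    (absGaloisRestrict (((Rat.HeightOneSpectrum.primesEquiv (R := 𝓞 ℚ)).symm ⟨3, Fact.out⟩).adicCompletion ℚ) (w₀.1.adicCompletion (CyclotomicField (cycLevel 3 0 r) ℚ)))) dw hinjw hexw) (oneCocycleClass _ ψT)))) ∧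
          ∀ (c d a : ℤ) (A : ℕ), 0 < A → Int.gcd c (6 * 3 * A) = 1 → Int.gcd d (6 * 3 * N) = 1 →
            ∃ (z : ∀ (k' : ℕ) (r : (cyclotomicLevelsRat 3 (badPlaces c d A N)).Ideals),
                  H1 (tateRep W 3) ((cyclotomicLevelsRat 3 (badPlaces c d A N)).level k' r.1))
              (x : ∀ (k' : ℕ) (r : (cyclotomicLevelsRat 3 (badPlaces c d A N)).Ideals),
                  CyclotomicField (cycLevel 3 k' r.1) ℚ),
              ZetaBody W 3 P.f ι κK Λ c d a A z x := by
  intro W _ _ _ _ _ htow N _ P hN hlat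
  haveI : Fact (((3 : ℕ) : 𝓞 ℚ) ∈ ((Rat.HeightOneSpectrum.primesEquiv (R := 𝓞 ℚ)).symm ⟨3, Fact.out⟩).asIdeal) :=
    ⟨(natCast_mem_asIdeal_iff_eq_primesEquiv_symm _ Nat.prime_three).mpr rfl⟩
  letI := valuativeRelPlace ((Rat.HeightOneSpectrum.primesEquiv (R := 𝓞 ℚ)).symm ⟨3, Fact.out⟩)
  letI := topologicalSpacePlace ((Rat.HeightOneSpectrum.primesEquiv (R := 𝓞 ℚ)).symm ⟨3, Fact.out⟩)
  haveI := isNonarchimedeanLocalField_place ((Rat.HeightOneSpectrum.primesEquiv (R := 𝓞 ℚ)).symm ⟨3, Fact.out⟩)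
  haveI := charZero_place ((Rat.HeightOneSpectrum.primesEquiv (R := 𝓞 ℚ)).symm ⟨3, Fact.out⟩)
  letI := padicAlgebraPlace 3 ((Rat.HeightOneSpectrum.primesEquiv (R := 𝓞 ℚ)).symm ⟨3, Fact.out⟩)
  haveI := fact_not_isUnit_place 3 ((Rat.HeightOneSpectrum.primesEquiv (R := 𝓞 ℚ)).symm ⟨3, Fact.out⟩)
  haveI := isAdicComplete_place 3 ((Rat.HeightOneSpectrum.primesEquiv (R := 𝓞 ℚ)).symm ⟨3, Fact.out⟩)
  obtain ⟨dK, ι, κK, Λ, hκ0, hkat, hz⟩ := hKatoEx W htow P hN hlat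
  -- Kato's Prop. 1.2.3 binders from the cite facts (w2-c3), read ONCE in this statement's instance spelling
  obtain ⟨hinj, hex⟩ :
      (bdRPeriodRingData (valuation_place_lt_one 3 ((Rat.HeightOneSpectrum.primesEquiv (R := 𝓞 ℚ)).symm ⟨3, Fact.out⟩))).CupLogInjective (logCyclotomic 3)
          (localRationalTateRep W 3 (galRestrictPlace ((Rat.HeightOneSpectrum.primesEquiv (R := 𝓞 ℚ)).symm ⟨3, Fact.out⟩))) ∧
        ∀ z : contOneCocycles (localRationalTateRep W 3 (galRestrictPlace ((Rat.HeightOneSpectrum.primesEquiv (R := 𝓞 ℚ)).symm ⟨3, Fact.out⟩))).toTopRep,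
          (bdRPeriodRingData (valuation_place_lt_one 3 ((Rat.HeightOneSpectrum.primesEquiv (R := 𝓞 ℚ)).symm ⟨3, Fact.out⟩))).HasDualExp (logCyclotomic 3)
            (localRationalTateRep W 3 (galRestrictPlace ((Rat.HeightOneSpectrum.primesEquiv (R := 𝓞 ℚ)).symm ⟨3, Fact.out⟩))) fun σ => z.1 σ :=
    hinj_hex_of_facts W 3 ((Rat.HeightOneSpectrum.primesEquiv (R := 𝓞 ℚ)).symm ⟨3, Fact.out⟩) hP hDR
  -- (S5b): a duality-normalised rescaling `e • d_K` of Kato's line datum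
  obtain ⟨e, he, hdual₀⟩ := hdual_of_facts_of_ringHom W 3 ((Rat.HeightOneSpectrum.primesEquiv (R := 𝓞 ℚ)).symm ⟨3, Fact.out⟩) hT dK hinj hex
    (((Padic.adicCompletionEquiv (𝓞 ℚ) ⟨3, Fact.out⟩).symm : (((Rat.HeightOneSpectrum.primesEquiv (R := 𝓞 ℚ)).symm ⟨3, Fact.out⟩).adicCompletion ℚ) →+* ℚ_[3]))
  have hAte : ∀ h, expStarOmegaAt (dK.smul e he) h = e⁻¹ * expStarOmegaAt dK h :=
    fun h => expStarOmega_smul _ _ dK he h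
  -- `ε := e₃⁻¹ e`, read off the DEFINED functional, split as `3ⁿ · w` with `‖w‖ = 1`
  have hε' : ∃ ε : ℚ_[3], ε ≠ 0 ∧ ∀ y,
      expStarOmegaPadicAt (dK.smul e he) hinj hex (((Padic.adicCompletionEquiv (𝓞 ℚ) ⟨3, Fact.out⟩).symm : (((Rat.HeightOneSpectrum.primesEquiv (R := 𝓞 ℚ)).symm ⟨3, Fact.out⟩).adicCompletion ℚ) →+* ℚ_[3])) y =
        ε⁻¹ * expStarOmegaPadicAt dK hinj hex (((Padic.adicCompletionEquiv (𝓞 ℚ) ⟨3, Fact.out⟩).symm : (((Rat.HeightOneSpectrum.primesEquiv (R := 𝓞 ℚ)).symm ⟨3, Fact.out⟩).adicCompletion ℚ) →+* ℚ_[3])) y :=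
    ⟨_, (map_ne_zero_iff _ (RingHom.injective
        (((Padic.adicCompletionEquiv (𝓞 ℚ) ⟨3, Fact.out⟩).symm : (((Rat.HeightOneSpectrum.primesEquiv (R := 𝓞 ℚ)).symm ⟨3, Fact.out⟩).adicCompletion ℚ) →+* ℚ_[3])))).mpr he,
      fun y => by rw [expStarOmegaPadicAt_apply, expStarOmegaPadicAt_apply, hAte, map_mul, map_inv₀]; rfl⟩
  obtain ⟨ε, hε0, hε⟩ := hε'
  have h3 : ((3 : ℕ) : ℚ_[3]) ≠ 0 := by exact_mod_cast (by norm_num : (3 : ℕ) ≠ 0)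
  have hn' : ∃ n : ℤ, ‖ε‖ = ((3 : ℕ) : ℝ) ^ (-n) := ⟨ε.valuation, Padic.norm_eq_zpow_neg_valuation hε0⟩
  obtain ⟨n, hnormε⟩ := hn'
  have hw' : ∃ w : ℚ_[3], w = ε * ((3 : ℕ) : ℚ_[3]) ^ (-n) := ⟨_, rfl⟩
  obtain ⟨w, hwdef⟩ := hw'
  have hw1 : ‖w‖ = 1 := by
    have h3R : (((3 : ℕ) : ℝ)) ^ (-n) ≠ 0 := zpow_ne_zero _ (by norm_num)
    rw [hwdef, norm_mul, norm_zpow, Padic.norm_p, hnormε, inv_zpow, mul_inv_cancel₀ h3R]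
  have hw0 : w ≠ 0 := norm_pos_iff.mp (by rw [hw1]; exact one_pos)
  have hεw : ((3 : ℕ) : ℚ_[3]) ^ n * w = ε := by
    rw [hwdef, mul_left_comm, ← zpow_add₀ h3, add_neg_cancel, zpow_zero, mul_one]
  -- the rescaling scalar `c := 3ⁿ ∈ ℚ_v` and the rational `q := 3⁻ⁿ`
  have h3v : ((3 : ℕ) : NumberField.Place.Completion (Sum.inr ((Rat.HeightOneSpectrum.primesEquiv (R := 𝓞 ℚ)).symm ⟨3, Fact.out⟩) : NumberField.Place ℚ)) ≠ 0 := by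
    exact_mod_cast (by norm_num : (3 : ℕ) ≠ 0)
  have hc' : ∃ c : NumberField.Place.Completion (Sum.inr ((Rat.HeightOneSpectrum.primesEquiv (R := 𝓞 ℚ)).symm ⟨3, Fact.out⟩) : NumberField.Place ℚ),
      c = ((3 : ℕ) : NumberField.Place.Completion (Sum.inr ((Rat.HeightOneSpectrum.primesEquiv (R := 𝓞 ℚ)).symm ⟨3, Fact.out⟩) : NumberField.Place ℚ)) ^ n := ⟨_, rfl⟩
  obtain ⟨c, hcdef⟩ := hc'
  have hc : c ≠ 0 := by rw [hcdef]; exact zpow_ne_zero _ h3v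
  have hAt : ∀ h, expStarOmegaAt (dK.smul c hc) h = c⁻¹ * expStarOmegaAt dK h :=
    fun h => expStarOmega_smul _ _ dK hc h
  have hιc : ∀ y,
      expStarOmegaPadicAt (dK.smul c hc) hinj hex (((Padic.adicCompletionEquiv (𝓞 ℚ) ⟨3, Fact.out⟩).symm : (((Rat.HeightOneSpectrum.primesEquiv (R := 𝓞 ℚ)).symm ⟨3, Fact.out⟩).adicCompletion ℚ) →+* ℚ_[3])) y =
        (((3 : ℕ) : ℚ_[3]) ^ n)⁻¹ *
          expStarOmegaPadicAt dK hinj hex (((Padic.adicCompletionEquiv (𝓞 ℚ) ⟨3, Fact.out⟩).symm : (((Rat.HeightOneSpectrum.primesEquiv (R := 𝓞 ℚ)).symm ⟨3, Fact.out⟩).adicCompletion ℚ) →+* ℚ_[3])) y := by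
    intro y
    rw [expStarOmegaPadicAt_apply, expStarOmegaPadicAt_apply, hAt, map_mul, map_inv₀, hcdef, map_zpow₀,
      map_natCast]
  have hq' : ∃ q : ℚ, q = ((3 : ℕ) : ℚ) ^ (-n) := ⟨_, rfl⟩
  obtain ⟨q, hqdef⟩ := hq'
  have hq : (q : ℚ_[3]) = (((3 : ℕ) : ℚ_[3]) ^ n)⁻¹ := by
    rw [hqdef, Rat.cast_zpow, Rat.cast_natCast, zpow_neg]
  have hq0 : q ≠ 0 := by rw [hqdef]; exact zpow_ne_zero _ (by norm_num)
  have he₃q : (Padic.adicCompletionEquiv (𝓞 ℚ) ⟨3, Fact.out⟩) (q : ℚ_[3]) = c⁻¹ := by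
    rw [hq, map_inv₀, map_zpow₀, map_natCast, hcdef]
  -- `exp*` at `ℚ₃`: the `c`-rescaled datum is `w` times the duality-normalised one
  have hφ : ∀ y, expStarOmegaPadicAt (dK.smul c hc) hinj hex
      (((Padic.adicCompletionEquiv (𝓞 ℚ) ⟨3, Fact.out⟩).symm : (((Rat.HeightOneSpectrum.primesEquiv (R := 𝓞 ℚ)).symm ⟨3, Fact.out⟩).adicCompletion ℚ) →+* ℚ_[3])) y =
      w * expStarOmegaPadicAt (dK.smul e he) hinj hex
        (((Padic.adicCompletionEquiv (𝓞 ℚ) ⟨3, Fact.out⟩).symm : (((Rat.HeightOneSpectrum.primesEquiv (R := 𝓞 ℚ)).symm ⟨3, Fact.out⟩).adicCompletion ℚ) →+* ℚ_[3])) y := by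
    intro y
    rw [hιc, hε, ← hεw, mul_inv, mul_comm ((((3 : ℕ) : ℚ_[3]) ^ n)⁻¹) w⁻¹, mul_assoc w⁻¹,
      mul_inv_cancel_left₀ hw0]
  refine ⟨dK.smul c hc, hinj, hex, ?_, ι, (q : ℝ) * κK, fun k' r => (q : ℚ_[3]) • Λ k' r,
    mul_ne_zero (by exact_mod_cast hq0) hκ0, ?_, ?_⟩
  · -- `hdual` for the rescaled datum: the lattice `{a : ‖a · log_ω Q‖ ≤ 1}` is stable under `3`-adic units
    intro a
    constructor
    · rintro ⟨y, hy⟩ Q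
      have hy' : expStarOmegaPadicAt (dK.smul e he) hinj hex
          (((Padic.adicCompletionEquiv (𝓞 ℚ) ⟨3, Fact.out⟩).symm : (((Rat.HeightOneSpectrum.primesEquiv (R := 𝓞 ℚ)).symm ⟨3, Fact.out⟩).adicCompletion ℚ) →+* ℚ_[3])) y = w⁻¹ * a := by
        rw [← hy, hφ, inv_mul_cancel_left₀ hw0]
      have hQ := ((hdual₀ (w⁻¹ * a)).mp ⟨y, hy'⟩) Q
      rwa [mul_assoc, norm_mul, norm_inv, hw1, inv_one, one_mul] at hQ
    · intro ha
      obtain ⟨y, hy⟩ := (hdual₀ (w⁻¹ * a)).mpr fun Q => by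
        rw [mul_assoc, norm_mul, norm_inv, hw1, inv_one, one_mul]; exact ha Q
      exact ⟨y, by rw [hφ, hy, mul_inv_cancel_left₀ hw0]⟩
  · -- the Kato block: (RES₀)/(DEF₀) transported along the scale laws
    intro j r Ψ hΨ
    have hk := hkat j r Ψ hΨ
    obtain ⟨w₀, g, hg, dw, hinjw, hexw, hres, hdef⟩ := hk
    letI := LocalField.charZero_adicCompletion w₀.1
    letI := LocalField.adicCompletionPadicAlgebra w₀.1 3 (three_mem_asIdeal_extension _ w₀)
    haveI : Fact (¬ IsUnit ((3 : ℕ) : integerC (w₀.1.adicCompletion (CyclotomicField (cycLevel 3 0 r) ℚ)))) :=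
      ⟨not_isUnit_natCast_integerC (LocalField.valuation_adicCompletion_natCast_lt_one w₀.1 3 (three_mem_asIdeal_extension _ w₀))⟩
    haveI := isAdicComplete_integerC_natCast (LocalField.valuation_adicCompletion_natCast_lt_one w₀.1 3 (three_mem_asIdeal_extension _ w₀))
    have hcw : algebraMap (((Rat.HeightOneSpectrum.primesEquiv (R := 𝓞 ℚ)).symm ⟨3, Fact.out⟩).adicCompletion ℚ) (w₀.1.adicCompletion (CyclotomicField (cycLevel 3 0 r) ℚ)) c ≠ 0 :=
      (map_ne_zero_iff _ (algebraMap (((Rat.HeightOneSpectrum.primesEquiv (R := 𝓞 ℚ)).symm ⟨3, Fact.out⟩).adicCompletion ℚ) (w₀.1.adicCompletion (CyclotomicField (cycLevel 3 0 r) ℚ))).injective).mpr hc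
    refine ⟨w₀, g, hg, dw.smul _ hcw, hinjw, hexw, fun h => ?_, fun w' y φ'' ψT hφ'' hψT => ?_⟩
    · -- (RES₀)
      have hres' := hres h
      rw [expStarOmegaHom_apply] at hres'
      rw [expStarOmegaHom_apply, expStarOmega_smul, hres', hAt, map_mul, map_inv₀]
    · -- (DEF₀)
      have hdef' := hdef w' y φ'' ψT hφ'' hψT
      rw [expStarOmegaHom_apply] at hdef'
      have hsm := padicTensor_map_smul (Ψ : _ →ₐ[ℚ] _) (fun s x w => hΨ s x w) (q : ℚ_[3]) (Λ 0 r y) w'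
      simp only [AlgEquiv.coe_toAlgHom] at hsm
      -- the scale law at `L_{w₀}` for the transported class
      have hR : expStarOmegaHom (LocalField.valuation_adicCompletion_natCast_lt_one w₀.1 3 (three_mem_asIdeal_extension _ w₀)) ((galRestrictPlace ((Rat.HeightOneSpectrum.primesEquiv (R := 𝓞 ℚ)).symm ⟨3, Fact.out⟩)).comp (absGaloisRestrict (((Rat.HeightOneSpectrum.primesEquiv (R := 𝓞 ℚ)).symm ⟨3, Fact.out⟩).adicCompletion ℚ) (w₀.1.adicCompletion (CyclotomicField (cycLevel 3 0 r) ℚ))))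
          (dw.smul _ hcw) hinjw hexw (oneCocycleClass _ ψT) =
          (algebraMap (((Rat.HeightOneSpectrum.primesEquiv (R := 𝓞 ℚ)).symm ⟨3, Fact.out⟩).adicCompletion ℚ) (w₀.1.adicCompletion (CyclotomicField (cycLevel 3 0 r) ℚ)) c)⁻¹ *
            expStarOmega (LocalField.valuation_adicCompletion_natCast_lt_one w₀.1 3 (three_mem_asIdeal_extension _ w₀)) ((galRestrictPlace ((Rat.HeightOneSpectrum.primesEquiv (R := 𝓞 ℚ)).symm ⟨3, Fact.out⟩)).comp (absGaloisRestrict (((Rat.HeightOneSpectrum.primesEquiv (R := 𝓞 ℚ)).symm ⟨3, Fact.out⟩).adicCompletion ℚ) (w₀.1.adicCompletion (CyclotomicField (cycLevel 3 0 r) ℚ)))) dw (oneCocycleClass _ ψT) := by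
        rw [expStarOmegaHom_apply, expStarOmega_smul]
      -- transport of the scale factor along `S_{w'} = (g̃_{w'}⁻¹)_*` (term-mode: no pattern search in the big goal)
      have hS : galAdicCompletionMap (sigma (cycLevel 3 0 r) (modNCyclotomicCharacter ℚ (cycLevel 3 0 r) (g w')))⁻¹
            (inv_smul_eq_of_smul_eq (hg w'))
            ((algebraMap (((Rat.HeightOneSpectrum.primesEquiv (R := 𝓞 ℚ)).symm ⟨3, Fact.out⟩).adicCompletion ℚ) (w₀.1.adicCompletion (CyclotomicField (cycLevel 3 0 r) ℚ)) c)⁻¹ * expStarOmega (LocalField.valuation_adicCompletion_natCast_lt_one w₀.1 3 (three_mem_asIdeal_extension _ w₀)) ((galRestrictPlace ((Rat.HeightOneSpectrum.primesEquiv (R := 𝓞 ℚ)).symm ⟨3, Fact.out⟩)).comp (absGaloisRestrict (((Rat.HeightOneSpectrum.primesEquiv (R := 𝓞 ℚ)).symm ⟨3, Fact.out⟩).adicCompletion ℚ) (w₀.1.adicCompletion (CyclotomicField (cycLevel 3 0 r) ℚ)))) dw (oneCocycleClass _ ψT)) =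
          (algebraMap (((Rat.HeightOneSpectrum.primesEquiv (R := 𝓞 ℚ)).symm ⟨3, Fact.out⟩).adicCompletion ℚ) (w'.1.adicCompletion (CyclotomicField (cycLevel 3 0 r) ℚ)) c)⁻¹ *
            galAdicCompletionMap (sigma (cycLevel 3 0 r) (modNCyclotomicCharacter ℚ (cycLevel 3 0 r) (g w')))⁻¹
              (inv_smul_eq_of_smul_eq (hg w')) (expStarOmega (LocalField.valuation_adicCompletion_natCast_lt_one w₀.1 3 (three_mem_asIdeal_extension _ w₀)) ((galRestrictPlace ((Rat.HeightOneSpectrum.primesEquiv (R := 𝓞 ℚ)).symm ⟨3, Fact.out⟩)).comp (absGaloisRestrict (((Rat.HeightOneSpectrum.primesEquiv (R := 𝓞 ℚ)).symm ⟨3, Fact.out⟩).adicCompletion ℚ) (w₀.1.adicCompletion (CyclotomicField (cycLevel 3 0 r) ℚ)))) dw (oneCocycleClass _ ψT)) :=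
        (map_mul _ _ _).trans (congrArg (· * _) ((map_inv₀ _ _).trans
          (congrArg Inv.inv (galAdicCompletionMap_algebraMap_adicCompletion ((Rat.HeightOneSpectrum.primesEquiv (R := 𝓞 ℚ)).symm ⟨3, Fact.out⟩)
            (sigma (cycLevel 3 0 r) (modNCyclotomicCharacter ℚ (cycLevel 3 0 r) (g w')))⁻¹ w₀ w'
            (inv_smul_eq_of_smul_eq (hg w')) c))))
      show Ψ ((q : ℚ_[3]) • Λ 0 r y) w' = _
      rw [hsm, hdef', he₃q, hR, hS]
      exact congrArg (· * _) (map_inv₀ _ c)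
  · -- Kato's body for the rationally rescaled witnesses
    intro c' d' a' A' hA hc' hd'
    obtain ⟨z, x, hbody⟩ := hz c' d' a' A' hA hc' hd'
    exact ⟨z, fun k' r => q • x k' r, zetaBody_rat_smul q hbody⟩

end Summit.BirchSwinnertonDyer.BirchSwinnertonDyer.Theorems.KimAtThreeDeepLowerKatoPartsRescale

end
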